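import Mathlib

/-!
# Crux `FeketeSOS.CharPSparseSOS` (stmt-ValiantsHypothesis-14989), line `Sketch` — stub `stub_dictionaryAtInfinity`

Dictionary at the upper cusp: for a polynomial `P` of degree `< p` over a field `K` of
characteristic `p` and `D ≤ p`, `(X - 1)^D ∣ P` iff the power moments `μ_a = Σ_{n<p} P_n n^a`
(`0^0 = 1`) of the coefficient function vanish for all `a < D`.

Proof (Mathlib's root-multiplicity / iterated-derivative criterion).  For `P ≠ 0`,
`(X-1)^D ∣ P ↔ D ≤ rootMultiplicity 1 P` (`le_rootMultiplicity_iff`), and for `D = d+1`,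
`d < rootMultiplicity 1 P ↔ ∀ m ≤ d, P^{(m)}(1) = 0` because `d! ≠ 0` in `K` for `d < p`
(`lt_rootMultiplicity_iff_isRoot_iterate_derivative_of_mem_nonZeroDivisors`, `Nat.Prime.dvd_factorial`).
Next `P^{(a)}(1) = Σ_{n<p} P_n · n(n-1)⋯(n-a+1)` (falling-factorial moments,
`iterate_derivative_X_pow_eq_C_mul`), and since `descPochhammer K a` is monic of degree `a`, the
conditions "all falling-factorial moments of order `< D` vanish" and "all power moments of order
`< D` vanish" are equivalent by a triangular change of basis (induction on `D`).
-/

-- `Summit.ValiantsHypothesis.ValiantsHypothesis.…` is the tree's mandated single-conjunct layout (Sub = Summit).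
set_option linter.dupNamespace false

namespace Summit.ValiantsHypothesis.ValiantsHypothesis.Theorems.CharPSparseSOSTwoCusp

open Polynomial Finset

/-- Falling-factorial moments: if `deg P < N` then `P^{(a)}(1) = Σ_{n<N} P_n · n(n-1)⋯(n-a+1)`. -/
theorem eval_one_iterate_derivative_eq_sum_descFactorial {K : Type*} [CommRing K] (P : K[X])
    (N a : ℕ) (hdeg : P.natDegree < N) :
    (derivative^[a] P).eval 1 = ∑ n ∈ range N, P.coeff n * (n.descFactorial a : K) := by
  conv_lhs => rw [P.as_sum_range' N hdeg]
  rw [iterate_derivative_sum, eval_finsetSum]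
  refine sum_congr rfl fun n _ => ?_
  rw [← C_mul_X_pow_eq_monomial, iterate_derivative_C_mul, iterate_derivative_X_pow_eq_C_mul,
    eval_mul, eval_C, eval_mul, eval_C, eval_pow, eval_X, one_pow, mul_one]

/-- A falling factorial is a monic polynomial in its argument:
`n(n-1)⋯(n-D+1) = n^D + Σ_{i<D} q_i n^i` with `q_i` the coefficients of `descPochhammer K D`. -/
theorem cast_descFactorial_eq_pow_add_sum {K : Type*} [Field K] (n D : ℕ) :
    (n.descFactorial D : K) =
      (n : K) ^ D + ∑ i ∈ range D, (descPochhammer K D).coeff i * (n : K) ^ i := by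
  have hdeg : (descPochhammer K D).natDegree < D + 1 := by
    rw [descPochhammer_natDegree]; exact Nat.lt_succ_self D
  have hlead : (descPochhammer K D).coeff D = 1 := by
    have h := (monic_descPochhammer K D).coeff_natDegree
    rwa [descPochhammer_natDegree] at h
  rw [← descPochhammer_eval_eq_descFactorial K n D, eval_eq_sum_range' hdeg, sum_range_succ, hlead,
    one_mul, add_comm]

/-- Triangular change of basis: the falling-factorial moments of order `< D` of a coefficient
function all vanish iff its power moments of order `< D` all vanish. -/
theorem forall_sum_mul_descFactorial_eq_zero_iff {K : Type*} [Field K] (s : Finset ℕ)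
    (c : ℕ → K) (D : ℕ) :
    (∀ a, a < D → ∑ n ∈ s, c n * (n.descFactorial a : K) = 0) ↔
      (∀ a, a < D → ∑ n ∈ s, c n * (n : K) ^ a = 0) := by
  induction D with
  | zero => simp
  | succ D ih =>
    -- under the vanishing of the lower power moments, the two order-`D` moments agree
    have key : (∀ a, a < D → ∑ n ∈ s, c n * (n : K) ^ a = 0) →
        ∑ n ∈ s, c n * (n.descFactorial D : K) = ∑ n ∈ s, c n * (n : K) ^ D := by
      intro h
      simp_rw [cast_descFactorial_eq_pow_add_sum, mul_add, sum_add_distrib, mul_sum]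
      rw [sum_comm, add_eq_left]
      refine sum_eq_zero fun i hi => ?_
      have hi' : ∑ n ∈ s, c n * ((descPochhammer K D).coeff i * (n : K) ^ i) =
          (descPochhammer K D).coeff i * ∑ n ∈ s, c n * (n : K) ^ i := by
        rw [mul_sum]
        exact sum_congr rfl fun n _ => by ring
      rw [hi', h i (mem_range.mp hi), mul_zero]
    constructor
    · intro h a ha
      have hlow : ∀ b, b < D → ∑ n ∈ s, c n * (n : K) ^ b = 0 :=
        ih.mp fun b hb => h b (Nat.lt_succ_of_lt hb)
      rcases Nat.lt_succ_iff_lt_or_eq.mp ha with ha | rfl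
      · exact hlow a ha
      · rw [← key hlow]
        exact h a (Nat.lt_succ_self a)
    · intro h a ha
      have hlow : ∀ b, b < D → ∑ n ∈ s, c n * (n : K) ^ b = 0 :=
        fun b hb => h b (Nat.lt_succ_of_lt hb)
      rcases Nat.lt_succ_iff_lt_or_eq.mp ha with ha | rfl
      · exact ih.mpr hlow a ha
      · rw [key hlow]
        exact h a (Nat.lt_succ_self a)

/-- **Dictionary at the upper cusp.** For `deg P < p = char K` and `D ≤ p`:
`(X - 1)^D ∣ P` iff the power moments `Σ_{n<p} P_n n^a` vanish for all `a < D` (`0^0 = 1`).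
The bound `D ≤ p` makes `(D-1)!` invertible in `K`. [folklore] -/
theorem stub_dictionaryAtInfinity :
    ∀ (K : Type) [Field K] (p : ℕ) [Fact p.Prime] [CharP K p] (P : K[X]) (D : ℕ),
      P.natDegree < p → D ≤ p →
        ((X - C (1 : K)) ^ D ∣ P ↔
          ∀ a : ℕ, a < D → ∑ n ∈ Finset.range p, P.coeff n * (n : K) ^ a = 0) := by
  intro K _ p _ _ P D hdeg hD
  rw [← forall_sum_mul_descFactorial_eq_zero_iff]
  simp_rw [← eval_one_iterate_derivative_eq_sum_descFactorial P p _ hdeg]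
  -- goal: `(X - C 1)^D ∣ P ↔ ∀ a < D, P^{(a)}(1) = 0`
  rcases eq_or_ne P 0 with rfl | hP
  · simp
  rw [← le_rootMultiplicity_iff hP]
  cases D with
  | zero => simp
  | succ d =>
    have hd : ((d.factorial : ℕ) : K) ∈ nonZeroDivisors K := by
      refine mem_nonZeroDivisors_of_ne_zero ?_
      rw [Ne, CharP.cast_eq_zero_iff K p, (Fact.out : p.Prime).dvd_factorial]
      omega
    rw [Nat.succ_le_iff,
      lt_rootMultiplicity_iff_isRoot_iterate_derivative_of_mem_nonZeroDivisors hP hd]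
    simp only [IsRoot.def, Nat.lt_succ_iff]

end Summit.ValiantsHypothesis.ValiantsHypothesis.Theorems.CharPSparseSOSTwoCusp
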